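import Summits.ResolutionOfSingularities.ResolutionOfSingularities.Theorems.WildConesCampaignW46HypersurfacesCharTwoSixClasses
import Summits.ResolutionOfSingularities.ResolutionOfSingularities.Theorems.WildConesCampaignW46HypersurfacesCharTwoIsolTransfer

/-!
# [OURS · L1 W4.6, rung (ii) at p = 2, EVERY dimension n] THE LINK `h₂ = 3 ⇒ THE TANGENT CUBIC VANISHES
# ON THE KERNEL PLANE`: at corank `e = 2`, the «no tangent cubic» class of gen 4 (`h₂ = dim 𝔪_A²/𝔪_A³ = 3`)
# has the WHOLE kernel line `ℙ(ker P) ≅ ℙ¹` as its locus of infinitely-near double points (all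
# non-isolated), and a kernel vector OFF the cubic forces `h₂ ≤ 2`: at most three near double points,
# all isolated — `z² = a(u₁,…,uₙ)` over every field of characteristic 2

HONEST FRAMING. Everything here is OURS: theorems about route WildCones' own TYPED point-blow-up dynamics
(`Theorems/WildConesClassicalRegimesDefs.lean`) and the seat's invariants `milnorEmbDim` (p498937: `e`),
`milnorHilbertTwo` (p511581: `h₂`), `polarMatrix` (p502936: `P`), `degForm` (p522667: `a₃ = degForm 3 (ser c)`).
NOTHING here is a statement of the manuscript [Hironaka2017]; no FACT-LIST premise; AI review is weaker
than expert review. Cell res-hironaka (LADDER-RESOLUTION rung L, D-0089), slot W4.6, seat res-L1-s46-pv-4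
(gen 5); host route `WildCones`, crux `ClassicalRegimes` (stmt-ResolutionOfSingularities-16884; proved).

THE ARGUMENT (pure commutative algebra in `R = κ⟦X₁,…,Xₙ⟧`, `J = (∂f)`, `𝔪`). `e = 2` means
`dim R/(J+𝔪²) = 3`: the classes of the variables span a proper subspace, of dimension `≤ 2`, so two
LINEAR FORMS `x, y` generate `𝔪` modulo `J + 𝔪²` (`exists_linear_pair_of_jetTwoColength_eq_three`, companion file
`…HypersurfacesCharTwoSixClasses.lean`). Then
`x², xy, y²` generate `𝔪²` modulo `𝔪J + 𝔪³` (`exists_quadratic_coeffs`), and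
`1, x, y, x², xy, y²` span `R/(J+𝔪³)` (`top_le_span_six`). If `h₂ = 3`, that space has dimension `6`,
so the six classes are INDEPENDENT; a directional derivative `D_λ f = Σ λₛ∂ₛf` along a kernel vector
`λ` lies in `J ∩ 𝔪²`, is `≡ αx² + βxy + γy²` modulo `𝔪J + 𝔪³ ⊆ J + 𝔪³`, hence `α = β = γ = 0` and
`D_λ f ∈ 𝔪J + 𝔪³` (`sum_C_mul_pderiv_mem_of_jetThree_eq_six`). The degree-form calculus (p528427: degree-2
forms vanish on `𝔪J + 𝔪³` along kernel vectors; Euler) turns this into the vanishing of the polar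
`Σ λₛ (∂ₛa)₂(v)` for all kernel vectors `λ, v`, and of `a₃(λ)` itself.

WHAT IS PROVED (every `n`, every field of characteristic `2`):

* `hypersurface_polar_eq_zero_of_milnorHilbertTwo_eq_three`,
  `hypersurface_cubic_eq_zero_of_milnorHilbertTwo_eq_three` — **`e = 2`, `h₂ = 3` ⇒ the tangent cubic and
  all its polars vanish on the kernel of the polar form**;
* `hypersurface_whole_kernel_near_of_milnorHilbertTwo_eq_three` — ⇒ (isolated state) EVERY non-zero kernel
  vector is an infinitely-near double point, and (gen 4) each of these successors is NON-isolated;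
* `hypersurface_milnorHilbertTwo_le_two_of_cubic_ne_zero` — a kernel vector with `a₃ ≠ 0` forces `h₂ ≤ 2`;
  `hypersurface_nearPoints_le_three_isolated` — then at most THREE infinitely-near double points and
  every double successor is ISOLATED with smaller Milnor number (gen 4's isolatedness transfer).

The converse (`a₃` and its polars vanish on the kernel ⇒ `h₂ = 3`) is NOT proved here.

References: G.-M. Greuel, G. Pfister, J. Algebra 689 (2026) [GreuelPfister2026] (context); E. Casas-Alvero,
Singularities of Plane Curves (2000) §3 [CasasAlvero2000] (tangent cone: context); H. Hironaka, ms. 2017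
[Hironaka2017] Th. 16.6 p.84 — role replaced only, under adjudication.
-/

noncomputable section

-- single-problem summit: the doubled namespace component `ResolutionOfSingularities` is forced
set_option linter.dupNamespace false

open scoped BigOperators Classical

open MvPowerSeries IsLocalRing

open Literature.AlgebraicGeometry.Resolution

namespace Summit.ResolutionOfSingularities.ResolutionOfSingularities.Theorems

namespace CampaignW46.HypersurfacesCharTwo

open WildCones WildCones.MuDropCharTwoOrdP ThreefoldsCharTwo

variable {κ : Type} [Field κ] {n : ℕ}

/-! ## The link, on the route's dynamics -/

/-- [OURS · L1 W4.6 rung (ii) at `p = 2`, every dimension; NOT a statement of the manuscript] **`h₂ = 3`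
⇒ ALL POLARS OF THE TANGENT CUBIC VANISH ON THE KERNEL PLANE.** For a double state `c` of
`z² = a(u₁,…,uₙ)` (any field of characteristic `2`) with `e(c) = 2` and `h₂(c) = 3`: for all kernel
vectors `λ, v` of the polar form, `Σₛ λₛ · degForm 2 (∂ₛ a) v = 0`. (`D_λ a ∈ 𝔪·(∂a) + 𝔪³` by the
dimension count, and degree-2 forms vanish there along kernel vectors.) [folklore] -/
theorem hypersurface_polar_eq_zero_of_milnorHilbertTwo_eq_three [CharP κ 2] (c : (Fin n → ℕ) → κ)
    (hM : MultP 2 n κ c) (he : milnorEmbDim 2 n κ c = 2) (hh : milnorHilbertTwo 2 n κ c = 3)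
    {lam v : Fin n → κ} (hlam : Matrix.vecMul lam (polarMatrix (ser 2 n κ c)) = 0)
    (hv : Matrix.vecMul v (polarMatrix (ser 2 n κ c)) = 0) :
    ∑ s, lam s * degForm 2 (MvPowerSeries.pderiv s (ser 2 n κ c)) v = 0 := by
  have hord := two_le_order_ser hM
  have hf' := ((FormalCoordChange.two_le_order_iff _).mp hord).2
  have h3 : jetTwoColength (ser 2 n κ c) = 3 := by
    have h := (milnorEmbDim_le_and_mod_two hM).2.2
    rw [h, he]
  have h6 : jetThreeColength (ser 2 n κ c) = 6 := by
    have h := (milnorHilbertTwo_range hM he).2.2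
    rw [h, hh]
  have hmem := sum_C_mul_pderiv_mem_of_jetThree_eq_six hord h3 h6 hlam
  have hv' : ∀ s, degForm 1 (MvPowerSeries.pderiv s (ser 2 n κ c)) v = 0 := fun s => by
    rw [degForm_one_pderiv_eq_vecMul, hv, Pi.zero_apply]
  rw [← degForm_two_sum_C_mul_pderiv]
  exact degForm_two_eq_zero_of_mem_maximalIdeal_mul_jac hf' hv' hmem

/-- [OURS · L1 W4.6 rung (ii) at `p = 2`, every dimension; NOT a statement of the manuscript] **`h₂ = 3`
⇒ THE TANGENT CUBIC VANISHES ON THE KERNEL PLANE**: for a double state with `e(c) = 2`, `h₂(c) = 3` and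
every kernel vector `w` of the polar form, `a₃(w) = degForm 3 (ser c) w = 0` (the cubic is its own polar
at the point in characteristic two). [folklore] -/
theorem hypersurface_cubic_eq_zero_of_milnorHilbertTwo_eq_three [CharP κ 2] (c : (Fin n → ℕ) → κ)
    (hM : MultP 2 n κ c) (he : milnorEmbDim 2 n κ c = 2) (hh : milnorHilbertTwo 2 n κ c = 3)
    {w : Fin n → κ} (hw : Matrix.vecMul w (polarMatrix (ser 2 n κ c)) = 0) :
    degForm 3 (ser 2 n κ c) w = 0 := by
  rw [degForm_three_eq_polar_self]
  exact hypersurface_polar_eq_zero_of_milnorHilbertTwo_eq_three c hM he hh hw hw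

/-- [OURS · L1 W4.6 rung (ii) at `p = 2`, every dimension; NOT a statement of the manuscript] **THE
«NO TANGENT CUBIC» CLASS HAS A WHOLE LINE OF INFINITELY-NEAR DOUBLE POINTS, ALL NON-ISOLATED**: for an
isolated double state of `z² = a(u₁,…,uₙ)` (characteristic `2`) with `e(c) = 2` and `h₂(c) = 3`, EVERY
non-zero kernel vector `w` of the polar form, read in the chart `i` of a non-zero coordinate at the
translation `w / w_i`, gives a double successor, and that successor is NOT isolated (gen 4,
`hypersurface_not_isol_step_of_milnorHilbertTwo_eq_three`). The forced (isolated) procedure stops;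
unforced, it branches along the kernel line `ℙ¹ ⊂ ℙ^{n−1}`. [folklore] -/
theorem hypersurface_whole_kernel_near_of_milnorHilbertTwo_eq_three [CharP κ 2] (c : (Fin n → ℕ) → κ)
    (hM : MultP 2 n κ c) (hI : Isol 2 n κ c) (he : milnorEmbDim 2 n κ c = 2)
    (hh : milnorHilbertTwo 2 n κ c = 3) {w : Fin n → κ} {i : Fin n}
    (hw : Matrix.vecMul w (polarMatrix (ser 2 n κ c)) = 0) (hwi : w i ≠ 0) :
    MultP 2 n κ (step 2 n κ i ((w i)⁻¹ • w) c) ∧ ¬ Isol 2 n κ (step 2 n κ i ((w i)⁻¹ • w) c) := by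
  have hM' := hypersurface_multP_step_of_vec c hM hI hwi hw
    (hypersurface_cubic_eq_zero_of_milnorHilbertTwo_eq_three c hM he hh hw)
  exact ⟨hM', hypersurface_not_isol_step_of_milnorHilbertTwo_eq_three c i _ hM he hh hM'⟩

/-- [OURS · L1 W4.6 rung (ii) at `p = 2`, every dimension; NOT a statement of the manuscript] **A KERNEL
VECTOR OFF THE TANGENT CUBIC FORCES `h₂ ≤ 2`**: for a double state with `e(c) = 2`, if some kernel vector
`v` of the polar form has `a₃(v) ≠ 0`, then `h₂(c) ≤ 2` (`h₂ ∈ {1,2,3}` and `h₂ = 3` is excluded by the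
previous theorem). [folklore] -/
theorem hypersurface_milnorHilbertTwo_le_two_of_cubic_ne_zero [CharP κ 2] (c : (Fin n → ℕ) → κ)
    (hM : MultP 2 n κ c) (he : milnorEmbDim 2 n κ c = 2) {v : Fin n → κ}
    (hv : Matrix.vecMul v (polarMatrix (ser 2 n κ c)) = 0) (hcub : degForm 3 (ser 2 n κ c) v ≠ 0) :
    milnorHilbertTwo 2 n κ c ≤ 2 := by
  have hr := milnorHilbertTwo_range hM he
  by_contra h
  exact hcub (hypersurface_cubic_eq_zero_of_milnorHilbertTwo_eq_three c hM he (by omega) hv)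

/-- [OURS · L1 W4.6 rung (ii) at `p = 2`, every dimension; NOT a statement of the manuscript] **A KERNEL
VECTOR OFF THE TANGENT CUBIC: AT MOST THREE INFINITELY-NEAR DOUBLE POINTS, ALL ISOLATED.** For an
isolated double state of `z² = a(u₁,…,uₙ)` (characteristic `2`) with `e(c) = 2` and a kernel vector `v`
with `a₃(v) ≠ 0`: (1) there is a set `S` of at most three vectors of which every near vector is a
multiple (`hypersurface_nearPoints_le_three`, p525636), and (2) every double successor is ISOLATED with
smaller Milnor number (`h₂ ≤ 2` and gen 4's `hypersurface_isol_step_of_milnorHilbertTwo_le_two`): the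
forced procedure continues, finitely branched. [folklore] -/
theorem hypersurface_nearPoints_le_three_isolated [CharP κ 2] (c : (Fin n → ℕ) → κ)
    (hM : MultP 2 n κ c) (hI : Isol 2 n κ c) (he : milnorEmbDim 2 n κ c = 2) {v : Fin n → κ}
    (hv : Matrix.vecMul v (polarMatrix (ser 2 n κ c)) = 0) (hcub : degForm 3 (ser 2 n κ c) v ≠ 0) :
    (∃ S : Finset (Fin n → κ), S.card ≤ 3 ∧
      ∀ (i : Fin n) (τ : Fin n → κ), MultP 2 n κ (step 2 n κ i τ c) →
        ∃ w ∈ S, ∃ r : κ, Function.update τ i 1 = r • w) ∧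
    ∀ (i : Fin n) (τ : Fin n → κ), MultP 2 n κ (step 2 n κ i τ c) →
      Isol 2 n κ (step 2 n κ i τ c) ∧ mu 2 n κ (step 2 n κ i τ c) < mu 2 n κ c :=
  ⟨hypersurface_nearPoints_le_three c hM hI he ⟨v, hv, hcub⟩,
    fun i τ hM' => hypersurface_isol_step_of_milnorHilbertTwo_le_two c i τ hM hI he
      (hypersurface_milnorHilbertTwo_le_two_of_cubic_ne_zero c hM he hv hcub) hM'⟩

end CampaignW46.HypersurfacesCharTwo

end Summit.ResolutionOfSingularities.ResolutionOfSingularities.Theorems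

end
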